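import Mathlib
import Literature.Computability.MetaComplexity.SmolenskyDimensionBound

/-!
# The Smolensky–Carlet counting lemma in rank–nullity form

Helper for line Sketch/LAR of crux stmt-QuantumAdvantage-1392. For functions on the cube
`{0,1}ⁿ` over a field `F`: if `f` and a degree-`≤ d` function `p` disagree exactly on the set
`E = {b : f b ≠ p b}`, then

  `dim lowDeg k ≤ |E| + dim (lowDeg k ⊓ V₁) + dim (lowDeg (k + d) ⊓ V₀)`

whenever `V₁` contains every function vanishing on `{f ≠ 0}` and `V₀` contains every function
vanishing on `{f = 0}` (the composition instantiates `V₁`, `V₀` with annihilator spaces). This is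
the dimension count in the proof of Carlet's bound on the higher-order nonlinearity of functions
of given algebraic immunity (cf. C. Carlet, *On the higher order nonlinearities of algebraic
immune functions*, CRYPTO 2006, proof of Thm. 1), itself a form of Smolensky's count
(Smolensky 1987, proof of Thm. 1): ignoring the points of `E` costs at most `|E|` dimensions
(rank–nullity for the restriction map to `E`), and on the space `W` of degree-`≤ k` functions
vanishing on `E` the multiplication map `h ↦ h · f = h · p` has range inside
`lowDeg (k + d) ⊓ V₀` and kernel inside `lowDeg k ⊓ V₁` (rank–nullity again).
-/

namespace Summit.QuantumAdvantage.DigitPolyUniformity.SketchLAR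

open Finset Module
open Literature.Computability.MetaComplexity.Smolensky (CubeFn mono lowDeg)

namespace AgreeCount

variable {F : Type*} [Field F] {n : ℕ}

/-- **Ignoring a finite set of points costs at most its size in dimension**: for every subspace
`L` of functions on the cube and every finite set `E` of points there is a subspace `K` of
functions vanishing on `E` (the kernel of the restriction map to `E`) with
`dim L ≤ |E| + dim (L ⊓ K)` (rank–nullity: `codim K ≤ |E|`). [folklore] -/
theorem exists_vanishing (L : Submodule F (CubeFn F n)) (E : Finset (Fin n → Bool)) :
    ∃ K : Submodule F (CubeFn F n), (∀ h ∈ K, ∀ b ∈ E, h b = 0) ∧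
      Module.finrank F ↥L ≤ E.card + Module.finrank F ↥(L ⊓ K) := by
  set r : CubeFn F n →ₗ[F] (↥E → F) := LinearMap.funLeft F F (Subtype.val : ↥E → (Fin n → Bool))
    with hr
  refine ⟨LinearMap.ker r, fun h hh b hb => ?_, ?_⟩
  · have := congrFun (LinearMap.mem_ker.1 hh) ⟨b, hb⟩
    rwa [hr, LinearMap.funLeft_apply, Pi.zero_apply] at this
  · -- rank–nullity for the restriction map: `codim K ≤ |E|`
    have hB : 2 ^ n ≤ Module.finrank F ↥(LinearMap.ker r) + E.card := by
      have h1 : Module.finrank F ↥(LinearMap.range r) + Module.finrank F ↥(LinearMap.ker r) =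
          2 ^ n :=
        (LinearMap.finrank_range_add_finrank_ker r).trans
          Literature.Computability.MetaComplexity.Smolensky.finrank_cubeFn
      have h2 : Module.finrank F ↥(LinearMap.range r) ≤ E.card := by
        refine (Submodule.finrank_le _).trans_eq ?_
        rw [Module.finrank_fintype_fun_eq_card, Fintype.card_coe]
      omega
    -- the dimension formula for `L ⊔ K`, `L ⊓ K`, and `dim (L ⊔ K) ≤ 2ⁿ`
    have hA : Module.finrank F ↥L + Module.finrank F ↥(LinearMap.ker r) ≤
        2 ^ n + Module.finrank F ↥(L ⊓ LinearMap.ker r) := by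
      have h3 : Module.finrank F ↥(L ⊔ LinearMap.ker r) +
          Module.finrank F ↥(L ⊓ LinearMap.ker r) =
          Module.finrank F ↥L + Module.finrank F ↥(LinearMap.ker r) :=
        Submodule.finrank_sup_add_finrank_inf_eq _ _
      have h4 : Module.finrank F ↥(L ⊔ LinearMap.ker r) ≤ 2 ^ n :=
        (Submodule.finrank_le _).trans_eq
          Literature.Computability.MetaComplexity.Smolensky.finrank_cubeFn
      omega
    omega

/-- **The multiplication-map count**: if every `h ∈ K` vanishes on the disagreement set
`{f ≠ p}` of `f` with a degree-`≤ d` function `p`, then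
`dim (lowDeg k ⊓ K) ≤ dim (lowDeg k ⊓ V₁) + dim (lowDeg (k + d) ⊓ V₀)`: on `W = lowDeg k ⊓ K` the
linear map `h ↦ h · f` equals `h ↦ h · p`, so its range lies in `lowDeg (k + d)` and (vanishing
where `f` does) in `V₀`, while its kernel consists of functions vanishing where `f ≠ 0`, hence
lies in `V₁`; conclude by rank–nullity. [folklore] -/
theorem finrank_inf_le {k d : ℕ} (f p : CubeFn F n) (hp : p ∈ lowDeg F n d)
    (K V₁ V₀ : Submodule F (CubeFn F n)) (hK : ∀ h ∈ K, ∀ b, f b ≠ p b → h b = 0)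
    (hV₁ : ∀ h : CubeFn F n, (∀ b, f b ≠ 0 → h b = 0) → h ∈ V₁)
    (hV₀ : ∀ h : CubeFn F n, (∀ b, f b = 0 → h b = 0) → h ∈ V₀) :
    Module.finrank F ↥(lowDeg F n k ⊓ K) ≤
      Module.finrank F ↥(lowDeg F n k ⊓ V₁) + Module.finrank F ↥(lowDeg F n (k + d) ⊓ V₀) := by
  set φ : ↥(lowDeg F n k ⊓ K) →ₗ[F] CubeFn F n :=
    (LinearMap.mulRight F f).comp (lowDeg F n k ⊓ K).subtype
  have hφapp : ∀ h : ↥(lowDeg F n k ⊓ K), φ h = (h : CubeFn F n) * f := fun h => rfl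
  -- the range lies in `lowDeg (k + d) ⊓ V₀`
  have hrange : LinearMap.range φ ≤ lowDeg F n (k + d) ⊓ V₀ := by
    rintro _ ⟨h, rfl⟩
    rw [hφapp]
    refine Submodule.mem_inf.2 ⟨?_, hV₀ _ fun b hb => by rw [Pi.mul_apply, hb, mul_zero]⟩
    have heq : (h : CubeFn F n) * f = (h : CubeFn F n) * p := by
      funext b
      rw [Pi.mul_apply, Pi.mul_apply]
      by_cases hb : f b = p b
      · rw [hb]
      · rw [hK _ (Submodule.mem_inf.1 h.2).2 b hb, zero_mul, zero_mul]
    rw [heq]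
    exact Literature.Computability.MetaComplexity.Smolensky.mul_mem_lowDeg_add
      (Submodule.mem_inf.1 h.2).1 hp
  -- the kernel lies in `lowDeg k ⊓ V₁`
  have hker : (LinearMap.ker φ).map (lowDeg F n k ⊓ K).subtype ≤ lowDeg F n k ⊓ V₁ := by
    rintro _ ⟨h, hh, rfl⟩
    have h0 : (h : CubeFn F n) * f = 0 := by
      rw [← hφapp]
      exact LinearMap.mem_ker.1 (SetLike.mem_coe.1 hh)
    refine Submodule.mem_inf.2 ⟨(Submodule.mem_inf.1 h.2).1, hV₁ _ fun b hb => ?_⟩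
    have := congrFun h0 b
    rw [Pi.mul_apply, Pi.zero_apply] at this
    exact (mul_eq_zero.1 this).resolve_right hb
  have h1 : Module.finrank F ↥(LinearMap.range φ) + Module.finrank F ↥(LinearMap.ker φ) =
      Module.finrank F ↥(lowDeg F n k ⊓ K) :=
    LinearMap.finrank_range_add_finrank_ker φ
  have h2 : Module.finrank F ↥(LinearMap.range φ) ≤ Module.finrank F ↥(lowDeg F n (k + d) ⊓ V₀) :=
    Submodule.finrank_mono hrange
  have h3 : Module.finrank F ↥(LinearMap.ker φ) ≤ Module.finrank F ↥(lowDeg F n k ⊓ V₁) :=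
    (Submodule.finrank_map_subtype_eq _ _).symm.trans_le (Submodule.finrank_mono hker)
  omega

end AgreeCount

/-- **The Smolensky–Carlet counting lemma** (rank–nullity form): for functions `f`, `p` on the
cube `{0,1}ⁿ` over a field `F` with `p` of degree `≤ d`, and subspaces `V₁ ⊇ {h : h = 0 on {f ≠ 0}}`,
`V₀ ⊇ {h : h = 0 on {f = 0}}`,
`dim lowDeg k ≤ |{b : f b ≠ p b}| + dim (lowDeg k ⊓ V₁) + dim (lowDeg (k + d) ⊓ V₀)`.
(Carlet, CRYPTO 2006, proof of Thm. 1; Smolensky 1987, proof of Thm. 1.) [folklore] -/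
theorem stub_agreeCount {F : Type*} [Field F] [DecidableEq F] {n k d : ℕ} (f p : CubeFn F n)
    (hp : p ∈ lowDeg F n d) (V₁ V₀ : Submodule F (CubeFn F n))
    (hV₁ : ∀ h : CubeFn F n, (∀ b, f b ≠ 0 → h b = 0) → h ∈ V₁)
    (hV₀ : ∀ h : CubeFn F n, (∀ b, f b = 0 → h b = 0) → h ∈ V₀) :
    Module.finrank F ↥(lowDeg F n k) ≤
      (univ.filter fun b => f b ≠ p b).card + Module.finrank F ↥(lowDeg F n k ⊓ V₁) +
        Module.finrank F ↥(lowDeg F n (k + d) ⊓ V₀) := by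
  obtain ⟨K, hK, h1⟩ :=
    AgreeCount.exists_vanishing (lowDeg F n k) (univ.filter fun b => f b ≠ p b)
  have h2 := AgreeCount.finrank_inf_le (k := k) f p hp K V₁ V₀
    (fun h hh b hb => hK h hh b (Finset.mem_filter.2 ⟨Finset.mem_univ b, hb⟩)) hV₁ hV₀
  omega

end Summit.QuantumAdvantage.DigitPolyUniformity.SketchLAR
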